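import Summits.QuantumFields.YangMills.Theorems.UnitScaleTiltProp7TentProfileZd
import Summits.QuantumFields.YangMills.Theorems.UnitScaleTiltProp7QprimeCombBumpSectionRows
import HarnessLib

/-!
# Route `UnitScaleTilt`, crux K1 «MinimiserStabilityRegPr» (stmt-QuantumFields-19200) — route-R E′ (A′), LANE II «DIVERGENCE RECOVERY AT CURVED `W`» (★★OWNER RULING №23),
# brick (B2a-F5a) «THE TENT PROFILE ON THE ℓ-BOX», FILE 2∕2 (the member): **the five profile slots of the bump-section files — `hβ` (periodicity, ✓p704472 `exists_bumpSection`),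
# `hB`∕`hβlip`∕`hβ0` (size `92`, in-block increments `183·η`, block-crossing zeros; ✓p705193 `norm_sq_DL2_section_le`) and `hβ1` (normalisation, ✓p704472
# `exists_exact_bumpSection_compT`) — are inhabited, each by ONE `exact`, by the inline tent profile of FILE 1 at `ℓ = L^{K−n}`, `d = (F.P K).d`** (★p1 g19 LANE II NAMER WORD №7 (4),
# 2026-08-29).

Cell `ym3-torus` ∕ width seat `ym3-torus-px9` (gen 7, «width 9»).  THEOREMS ONLY (0 `def`, 0 `sorry`); `--supports stmt-QuantumFields-19200 --as helper`, count-neutral.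
YM₃ on T³ is a ladder rung (R3), not d = 4, not the Clay problem; nothing here claims (B2a), the divergence-recovery row (REC), `hN06`, E′, EX or the gap.

THE PROFILE (inline, no `def`; `ℓ := (F.P K).L ^ (K − n)` as a natural number, `d := (F.P K).d`):
`β z := ((ℓ : ℝ)^d ∕ S^d) · Π_{i : Fin d} ((min (z i mod ℓ) (ℓ − 1 − z i mod ℓ) : ℤ) : ℝ)`, `S := Σ_{s ∈ range ℓ} ((min s (ℓ − 1 − s) : ℤ) : ℝ)`.

WHAT IS PROVED (ns `…Theorems.Prop7TentProfileBox`; `F : T3Family`, `n K : ℕ`): `odd_pow_level` (`n < K ⇒ ℓ` odd, `3 ≤ ℓ`), ★★★ `isPeriodic_profile` (`hβ`: `IsPeriodic ((F.P K).sitesPerDir 0) β`,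
`n ≤ K`), `profile_nonneg_member`, ★★ `abs_profile_le_member` (`hB` with `B := 92`), ★★★ `abs_profile_succ_sub_le_member` (`hβlip` with `B′ := 183`: in-block
`|β(z + e_μ) − β z| ≤ 183·eta F n K`), ★★ `profile_eq_zero_member` (`hβ0`), ★★★ `sum_blockIter_profile_member` (`hβ1`:
`Σ_{x ∈ blockIter L (K−n) y} (((L:ℝ)^d)⁻¹)^{K−n}·β x = 1`).
HONEST SCOPE.  Instantiation of FILE 1 at the member's block size; nothing of the lattice gauge theory, of print, of (B2a) ∕ (REC) ∕ `hN06` ∕ the crux is asserted; rung R3, not Clay;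
YM gap NOT proved.

References: T. Bałaban, CMP 99 (1985) 389–434 [Balaban1985BackgroundPropagators] ((3.17)–(3.19) p.393); T. Bałaban, CMP 98 (1985) 17–51 [Balaban1985Averaging] ((78)–(80) p.30);
T. Bałaban, CMP 99 (1985) 75–102 [Balaban1985RegularSpaces] (p.77: every block lattice divides the torus; Lemma 1 (1.25) p.79); [folklore].
-/

set_option autoImplicit false

namespace Summit.QuantumFields.YangMills.Theorems.Prop7TentProfileBox

open Literature.MathematicalPhysics.QuantumFieldTheory.Balaban1983to89
open Literature.MathematicalPhysics.QuantumFieldTheory.Balaban1983to89.T3ContinuumYM3Torus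
open Literature.MathematicalPhysics.QuantumLattice (blockMap)
open B7Prop1Explicit renaming Site → LSite
open B7Prop1Explicit (e)
open B9B8AveragingKernelZd (blockIter)
open T4TermwiseTorus (IsPeriodic)
open T3SectALandauChart (eta eta_pos)
open Summit.QuantumFields.YangMills.Theorems.Prop7QprimeCombL2 (sitesPerDir_zero_eq)
open Summit.QuantumFields.YangMills.Theorems.Prop7TentProfileZd

/-! ## §3 The rows at the member, in the letters of ✓p704472 `exists_bumpSection` ∕ ✓p705193 `norm_sq_DL2_section_le` (`ℓ = L^{K−n}`, `d = (F.P K).d = 3`) -/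

section Member

variable (F : T3Family) (n K : ℕ)

/-- `ℓ = L^{K−n}` is odd and `≥ 3` as soon as `n < K` (lit `T3Family.hL : Odd L ∧ 1 < L`). -/
theorem odd_pow_level (hnK : n < K) : Odd ((F.P K).L ^ (K - n)) ∧ 3 ≤ (F.P K).L ^ (K - n) := by
  have hL : Odd F.L ∧ 1 < F.L := F.hL
  have h3 : 3 ≤ F.L := by
    obtain ⟨m, hm⟩ := hL.1
    omega
  refine ⟨hL.1.pow, ?_⟩
  calc 3 ≤ F.L := h3
    _ ≤ F.L ^ (K - n) := Nat.le_self_pow (by omega) _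

/-- ★ (i) PERIODICITY at the member: the profile is `N₀`-periodic, `N₀ = (F.P K).sitesPerDir 0` (`= ℓ·N_{K−n}`, ✓`sitesPerDir_zero_eq`) — the `hβ` slot of ✓`exists_bumpSection`. -/
theorem isPeriodic_profile (hnK : n ≤ K) :
    IsPeriodic ((F.P K).sitesPerDir 0) (fun z : LSite (F.P K).d => (((((F.P K).L ^ (K - n) : ℕ) : ℝ) ^ (F.P K).d / (∑ s ∈ Finset.range ((F.P K).L ^ (K - n)), ((min (s : ℤ) ((((F.P K).L ^ (K - n) : ℕ) : ℤ) - 1 - (s : ℤ)) : ℤ) : ℝ)) ^ (F.P K).d) * ∏ i : Fin (F.P K).d, ((min ((z i) % (((F.P K).L ^ (K - n) : ℕ) : ℤ)) ((((F.P K).L ^ (K - n) : ℕ) : ℤ) - 1 - (z i) % (((F.P K).L ^ (K - n) : ℕ) : ℤ)) : ℤ) : ℝ))) := by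
  intro z m
  have hdvd : (F.P K).L ^ (K - n) ∣ (F.P K).sitesPerDir 0 := by
    rw [sitesPerDir_zero_eq F n K hnK]; exact dvd_mul_right _ _
  exact profile_add_period hdvd z m

/-- ★ (ii) SIGN and SIZE at the member: `0 ≤ β z` and `|β z| ≤ 92` (`(9∕2)³ = 91.125`) — the `hB` slot of ✓`norm_sq_DL2_section_le` with `B := 92`. -/
theorem profile_nonneg_member (z : LSite (F.P K).d) : 0 ≤ (((((F.P K).L ^ (K - n) : ℕ) : ℝ) ^ (F.P K).d / (∑ s ∈ Finset.range ((F.P K).L ^ (K - n)), ((min (s : ℤ) ((((F.P K).L ^ (K - n) : ℕ) : ℤ) - 1 - (s : ℤ)) : ℤ) : ℝ)) ^ (F.P K).d) * ∏ i : Fin (F.P K).d, ((min ((z i) % (((F.P K).L ^ (K - n) : ℕ) : ℤ)) ((((F.P K).L ^ (K - n) : ℕ) : ℤ) - 1 - (z i) % (((F.P K).L ^ (K - n) : ℕ) : ℤ)) : ℤ) : ℝ)) :=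
  profile_nonneg (pow_pos (by have := F.hL.2; show 0 < F.L; omega) _) z

/-- ★ (ii) `|β z| ≤ 92`. -/
theorem abs_profile_le_member (hnK : n < K) (z : LSite (F.P K).d) : |(((((F.P K).L ^ (K - n) : ℕ) : ℝ) ^ (F.P K).d / (∑ s ∈ Finset.range ((F.P K).L ^ (K - n)), ((min (s : ℤ) ((((F.P K).L ^ (K - n) : ℕ) : ℤ) - 1 - (s : ℤ)) : ℤ) : ℝ)) ^ (F.P K).d) * ∏ i : Fin (F.P K).d, ((min ((z i) % (((F.P K).L ^ (K - n) : ℕ) : ℤ)) ((((F.P K).L ^ (K - n) : ℕ) : ℤ) - 1 - (z i) % (((F.P K).L ^ (K - n) : ℕ) : ℤ)) : ℤ) : ℝ))| ≤ 92 := by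
  obtain ⟨hodd, h3⟩ := odd_pow_level F n K hnK
  refine (abs_profile_le hodd h3 z).trans ?_
  rw [show (F.P K).d = 3 from T3Family.P_d F K]
  norm_num

/-- ★ (iii) IN-BLOCK INCREMENTS at the member: `|β(z + e_μ) − β(z)| ≤ 183·η`, `η = eta F n K = ℓ⁻¹` — the `hβlip` slot with `B′ := 183` (`2·(9∕2)³ = 182.25`). -/
theorem abs_profile_succ_sub_le_member (hnK : n < K) (z : LSite (F.P K).d) (μ : Fin (F.P K).d)
    (h : (blockMap (F.P K).L)^[K - n] (z + e μ) = (blockMap (F.P K).L)^[K - n] z) :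
    |(((((F.P K).L ^ (K - n) : ℕ) : ℝ) ^ (F.P K).d / (∑ s ∈ Finset.range ((F.P K).L ^ (K - n)), ((min (s : ℤ) ((((F.P K).L ^ (K - n) : ℕ) : ℤ) - 1 - (s : ℤ)) : ℤ) : ℝ)) ^ (F.P K).d) * ∏ i : Fin (F.P K).d, ((min (((z + e μ) i) % (((F.P K).L ^ (K - n) : ℕ) : ℤ)) ((((F.P K).L ^ (K - n) : ℕ) : ℤ) - 1 - ((z + e μ) i) % (((F.P K).L ^ (K - n) : ℕ) : ℤ)) : ℤ) : ℝ)) - (((((F.P K).L ^ (K - n) : ℕ) : ℝ) ^ (F.P K).d / (∑ s ∈ Finset.range ((F.P K).L ^ (K - n)), ((min (s : ℤ) ((((F.P K).L ^ (K - n) : ℕ) : ℤ) - 1 - (s : ℤ)) : ℤ) : ℝ)) ^ (F.P K).d) * ∏ i : Fin (F.P K).d, ((min ((z i) % (((F.P K).L ^ (K - n) : ℕ) : ℤ)) ((((F.P K).L ^ (K - n) : ℕ) : ℤ) - 1 - (z i) % (((F.P K).L ^ (K - n) : ℕ) : ℤ)) : ℤ) : ℝ))| ≤ 183 * eta F n K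 := by
  obtain ⟨hodd, h3⟩ := odd_pow_level F n K hnK
  rw [iterate_blockMap_eq_blockMap_pow, iterate_blockMap_eq_blockMap_pow] at h
  refine (abs_profile_succ_sub_le hodd h3 z μ h).trans ?_
  have hη : ((((F.P K).L ^ (K - n) : ℕ) : ℝ))⁻¹ = eta F n K := by
    rw [Nat.cast_pow, ← inv_pow]; rfl
  rw [hη, show (F.P K).d = 3 from T3Family.P_d F K]
  have hηpos : 0 < eta F n K := eta_pos F n K
  nlinarith

/-- ★ (iv) BOUNDARY ZEROS at the member: on a block-crossing bond both endpoint values vanish — the `hβ0` slot. -/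
theorem profile_eq_zero_member (z : LSite (F.P K).d) (μ : Fin (F.P K).d)
    (h : (blockMap (F.P K).L)^[K - n] (z + e μ) ≠ (blockMap (F.P K).L)^[K - n] z) :
    (((((F.P K).L ^ (K - n) : ℕ) : ℝ) ^ (F.P K).d / (∑ s ∈ Finset.range ((F.P K).L ^ (K - n)), ((min (s : ℤ) ((((F.P K).L ^ (K - n) : ℕ) : ℤ) - 1 - (s : ℤ)) : ℤ) : ℝ)) ^ (F.P K).d) * ∏ i : Fin (F.P K).d, ((min ((z i) % (((F.P K).L ^ (K - n) : ℕ) : ℤ)) ((((F.P K).L ^ (K - n) : ℕ) : ℤ) - 1 - (z i) % (((F.P K).L ^ (K - n) : ℕ) : ℤ)) : ℤ) : ℝ)) = 0 ∧ (((((F.P K).L ^ (K - n) : ℕ) : ℝ) ^ (F.P K).d / (∑ s ∈ Finset.range ((F.P K).L ^ (K - n)), ((min (s : ℤ) ((((F.P K).L ^ (K - n) : ℕ) : ℤ) - 1 - (s : ℤ)) : ℤ) : ℝ)) ^ (F.P K).d) * ∏ i : Fin (F.P K).d, ((min (((z + e μ) i) % (((F.P K).L ^ (K - n) : ℕ) :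 ℤ)) ((((F.P K).L ^ (K - n) : ℕ) : ℤ) - 1 - ((z + e μ) i) % (((F.P K).L ^ (K - n) : ℕ) : ℤ)) : ℤ) : ℝ)) = 0 := by
  rw [iterate_blockMap_eq_blockMap_pow, iterate_blockMap_eq_blockMap_pow] at h
  exact profile_eq_zero_of_blockMap_ne (pow_pos (by have := F.hL.2; show 0 < F.L; omega) _) z μ h

/-- ★ (v) NORMALISATION at the member: `Σ_{x ∈ blockIter L (K−n) y} ((L^d)⁻¹)^{K−n}·β x = 1` — the `hβ1` slot of ✓`exists_exact_bumpSection_compT`. -/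
theorem sum_blockIter_profile_member (hnK : n < K) (y : LSite (F.P K).d) :
    ∑ x ∈ blockIter (F.P K).L (K - n) y, (((((F.P K).L : ℝ) ^ (F.P K).d)⁻¹) ^ (K - n) * (((((F.P K).L ^ (K - n) : ℕ) : ℝ) ^ (F.P K).d / (∑ s ∈ Finset.range ((F.P K).L ^ (K - n)), ((min (s : ℤ) ((((F.P K).L ^ (K - n) : ℕ) : ℤ) - 1 - (s : ℤ)) : ℤ) : ℝ)) ^ (F.P K).d) * ∏ i : Fin (F.P K).d, ((min ((x i) % (((F.P K).L ^ (K - n) : ℕ) : ℤ)) ((((F.P K).L ^ (K - n) : ℕ) : ℤ) - 1 - (x i) % (((F.P K).L ^ (K - n) : ℕ) : ℤ)) : ℤ) : ℝ))) = 1 := by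
  obtain ⟨hodd, h3⟩ := odd_pow_level F n K hnK
  haveI : NeZero (F.P K).L := ⟨by have := F.hL.2; show F.L ≠ 0; omega⟩
  exact sum_blockIter_weight_mul_profile (F.P K).L (K - n) hodd h3 y

end Member

end Summit.QuantumFields.YangMills.Theorems.Prop7TentProfileBox
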